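import Summits.Schanuel.Schanuel.Theorems.DiophantineDichotomyKhovanskiiApproxTypeSlotDichotomyTwo
import Summits.Schanuel.Schanuel.Theorems.DiophantineDichotomyKhovanskiiApproxTypeTransferOfSiegel
import Summits.Schanuel.Schanuel.Theorems.DiophantineDichotomyKhovanskiiApproxTypeSiegelInIdeal
import Summits.Schanuel.Schanuel.Theorems.EPiSimultaneousType.Negative.IrreducibleWitness

/-!
# Line `bounded-index-core` — skeleton for crux `DiophantineDichotomy.EPiSimultaneousType`
# (stmt-Schanuel-6118, route-Schanuel-DiophantineDichotomy, rank 4)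

See `Lines/bounded-index-core.md` (the line card) for the prose: idea, stubs, hardest stub,
barriers, Disproof used, triage answers.

THE CRUX. `∃ a < 1, b, C > 0`: for all `d, H ∈ ℕ`, all `γ = (γ₁, γ₂) ∈ ℂ²` with `[ℚ(γ₁, γ₂):ℚ] ≤ d`,
each `γᵢ` a root of a non-zero `Pᵢ ∈ ℤ[X]` of degree `≤ d` and naive height `≤ H`:
`max(|γ₁ − π|, |γ₂ − e|) ≥ exp(−C(dᵃ log H + dᵇ))`.

THE LINE (card `Ideas/bounded-index-core.md`, crux-ideate r2 ideator 6; triage r2: 3 × pass).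
Write `r = [ℚ(γ):ℚ] ≤ d`, `dᵢ = [ℚ(γᵢ):ℚ]`, and call `ι(γ) = maxᵢ r/dᵢ = maxᵢ [ℚ(γ):ℚ(γᵢ)]` the
ENTANGLEMENT INDEX of the challenger. The crux is cut by the index:

* THE CORE (bounded index `ι ≤ M`, the population the route's race `EPiRace` actually meets — every
  level-one approximant of a putative curve point `(π, e)` is a curve point, of index `≤ deg` of the
  curve). On the core the parent crux's LANDED transfer `CodimOneTransfer` (= `stub_transferOfSiegel
  stub_siegelInIdeal`, Siegel's lemma inside the ideal of the challenger, both proved in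
  `Theorems/`) turns ANY decoupled codimension-one measure of algebraic independence of `(π, e)` with
  total-degree exponent `μ < 3` (`stub_pairMeasure`, OPEN — the hardest stub) into the crux inequality
  with the clean exchange rate `a = (μ − 1)/2 < 1`, for EVERY `M` (`core_of_pairMeasure`, PROVED here:
  the idea's first lemma, kernel-checked).
* THE SEMI-ENTANGLED COMPLEMENT (`ι` large: one coordinate sits in a subfield of `ℚ(γ)` of large
  index, i.e. has small degree `< d^τ`). There the sup norm lets a ONE-variable floor at that
  coordinate win: `|f(ξ)| ≥ exp(−C₁((deg f)^A log H(f) + (deg f)^K))` applied to the minimal polynomial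
  of the small coordinate (`slot_repulsion`, landed with the parent line's `stub_slotDichotomy_two`).
  For `π` the floor with any `A > 1` is IN PRINT (Fel'dman / Nesterenko–Waldschmidt 1996 Thm 2(2):
  `stub_piFloor`, KNOWN, size L); for `e` only `A = 2` is in print (ibid. Thm 4(2)) and the line needs
  `A < 2/(μ − 1)` — the honest residual single-variable input `stub_eFloor` ("`e` has uniform
  polynomial type one at all heights with a polynomial penalty", OPEN; implied by the parent line's
  registered `stub_lwSmallHeight_one`, bridge `eFloor_of_lwSmallHeight_one` PROVED here).
* THE CUT between the two populations is made at index `ι ≍ d^{1−τ}`, `τ = p/(A+1)`, `p = (μ+1)/2`: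
  `cruxNF_of_primitive_and_floors` (PROVED here — the parent's slot dichotomy transplanted from
  `θ = (s, e^s) ∈ ℂ⁴` to `θ = (π, e) ∈ ℂ²`) gives the crux with `a = A·p/(A+1) < 1 ⟺ A(μ − 1) < 2`.
  So: any saving `μ < 3` on the pair side can be paid for by type `A < 2/(μ−1)` on the `e`-side, and
  conversely (`cruxNF_of_optimalPair_and_eSaving`, PROVED: an optimal-exponent pair measure `μ = 2 + o(1)`
  needs only SOME `A < 2` for `e`); the box-currency threshold `η₀ = (√17 − 3)/4` of TRIAGE-r1-3 §N is the
  special case `μ = 2 + 2η`, `A = 1 + η` of `A(μ − 1) < 2`.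

`EPiSimultaneousType_of : EPiSimultaneousType` composes the three stubs into the crux BY NAME
(kernel-checked; `sorry` only inside the three `stub_*`).

## Disproof used (`Cruxes/EPiSimultaneousType/Disproof.lean` v2, cdisprove cycles 1–2, NO KILL; read
2026-08-16 — its §0 vocabulary `θ`, `Admissible`, `bound` is COPIED here (as `theta`, `Admissible`,
`bound`) so that this skeleton does not break when the disprover rewrites its work file)
* §1 `crux_false_without_heightClause` — HONOURED: the integer-polynomial clause is consumed at BOTH
  ends: `slot_repulsion` feeds the clause's own `Pᵢ` (degree `≤ d`, height `≤ H`) to the floor via an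
  irreducible factor, and the transfer's Siegel step prices the challenger's Weil heights by
  `(log H + d)/d'` ("the line uses H at `cruxNF_of_primitive_and_floors`, both cases, and at
  `core_of_pairMeasure` through `clause_irreducible`").
* §2 `not_measureAt_liouvillePoint` / `not_forall_transcendental_measure` — all `(π, e)`-specific
  input is Diophantine and named: the pair measure at `theta` and the two floors at `π`, `e`; nothing
  is argued from transcendence alone. `not_crux_with_neg_exponent` (`a ≥ 0`), §2b
  `epiSimultaneousType_false_of_exponents_lt_half`, §3 `not_crux_half_of_weakAP2` /
  §3b `…half_false_of_coordLinear` (`a ≥ 1/2` modulo printed inputs) — CONSISTENT: Dirichlet forces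
  `μ ≥ 2` and `A ≥ 1` (§2b `polyMeasure_shape_false_of_exponent_lt_one`), so the line's output
  `a = A(μ+1)/(2(A+1)) ≥ 3/4 > 1/2` on the whole crux and `a = (μ−1)/2 ≥ 1/2` on the core.
* `crux_iff_normalised` / `measureAt_mono` — same normal-form bookkeeping here (`crux_iff`, `b`, `C`
  merged by `max`/sums inside the proofs).
* §3 `race` / `epiRace_kernel`, `crux_false_of_weakAP1` — route level (the core is what the race
  consumes); not used in this file, see the line card.
* §5 instance relation (LANDED `Negative/LiftClause`, `Negative/OfKhovanskiiApproxType`) — the line is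
  the `(1, iπ)`-fibre of the parent line `lw-small-height` of crux 6116: same transfer, same slot
  dichotomy, inputs = that line's `NonLWInputsTwo` at `s = (1, iπ)` read at the pair `(π, e)`.
* LANDED Negative lemmas (`Theorems/EPiSimultaneousType/Negative/*`): no stub is an instance —
  `NegExponentFalse` (`a < 0`), `LiouvillePointNoMeasure` (other base point), `RaceHalfFalse` /
  `CoordinatewiseLinear` (`a < 1/2`; common-field clause dropped), `BetaExpansion`/`BoundedHeightHalf`/
  `DirichletPoly` (`a, b < 1/2`; one-variable exponent `< 1`) are all outside the stubs' ranges
  (`μ < 3` is only claimed together with `0 ≤ μ`, and is consistent with Dirichlet's `μ ≥ 2`; the floors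
  are claimed only for `A > 1`); `IrreducibleWitness.clause_irreducible` is the TOOL of
  `core_of_pairMeasure`. `-- Targets`: the four stubs of `Lines/compositum-defect-split.lean`, none
  killable; this file shares none of them verbatim (its `stub_piFloor` is the `∀ A > 1` corollary family
  of that line's `stub_piTranscendenceMeasure`).
* `ledger negatives --problem Schanuel`: the two PolarPhantoms refutations — unrelated.
-/

set_option linter.dupNamespace false
set_option linter.unusedVariables false

noncomputable section

open Polynomial
open scoped IntermediateField

namespace Summit.Schanuel.Schanuel.Cruxes.EPiSimultaneousType.BoundedIndexCore

open Summit.Schanuel.Schanuel.Theses.DiophantineDichotomy (EPiSimultaneousType)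
open Summit.Schanuel.Schanuel.Cruxes.KhovanskiiApproxType.LwSmallHeight

/-! ## §0 Vocabulary of the crux (copy of `Disproof.lean` §0) -/

/-- The base point `θ = (π, e) ∈ ℂ²`, exactly as written in the crux. -/
def theta : Fin 2 → ℂ := ![(Real.pi : ℂ), (Real.exp 1 : ℂ)]

/-- The per-coordinate clause of the crux: `z` is a root of a non-zero integer polynomial of
degree `≤ n` and naive height `≤ H`. -/
def Clause (n H : ℕ) (z : ℂ) : Prop :=
  ∃ P : Polynomial ℤ, P ≠ 0 ∧ P.natDegree ≤ n ∧ (∀ k, |P.coeff k| ≤ (H : ℤ)) ∧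
    Polynomial.aeval z P = 0

/-- The admissibility clause of the crux for `(d, H, γ)`: `[ℚ(γ):ℚ] ≤ d` and `Clause d H (γ i)`
for both coordinates (same `Prop` as `Disproof.Admissible`). -/
def Admissible (d H : ℕ) (γ : Fin 2 → ℂ) : Prop :=
  Module.finrank ℚ ↥(IntermediateField.adjoin ℚ (Set.range γ)) ≤ d ∧ ∀ i, Clause d H (γ i)

/-- The lower bound `exp(−C(dᵃ log H + dᵇ))` of the crux. -/
def bound (a b C : ℝ) (d H : ℕ) : ℝ :=
  Real.exp (-(C * ((d : ℝ) ^ a * Real.log H + (d : ℝ) ^ b)))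

/-- The crux READ BACK in this vocabulary (its normal form; `crux_iff`). Intermediate results of
this file conclude `CruxNF`; only `EPiSimultaneousType_of` concludes the route decl by name. -/
def CruxNF : Prop :=
  ∃ a b C : ℝ, a < 1 ∧ 0 < C ∧ ∀ (d H : ℕ) (γ : Fin 2 → ℂ), Admissible d H γ →
    bound a b C d H ≤ ‖γ - theta‖

/-- READ-BACK: the crux is literally `CruxNF`. [folklore] -/
theorem crux_iff : EPiSimultaneousType ↔ CruxNF := by
  simp only [EPiSimultaneousType, CruxNF, Admissible, Clause, bound, theta, and_imp]

theorem theta_zero : theta 0 = (Real.pi : ℂ) := rfl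

theorem theta_one : theta 1 = (Real.exp 1 : ℂ) := rfl

/-! ## §1 The inputs (statements, in the parent line's landed vocabulary
`Theorems/DiophantineDichotomyDefs.lean`: `CodimOneMeasure`, `SlotFloor`, `PrimitiveApproxMeasure`) -/

/-- **Pair measure with total-degree exponent `μ`** — a decoupled codimension-one measure of
algebraic independence of `(π, e)`: `log|P(π, e)| ≥ −C((deg P)^μ log H(P) + (deg P)^K)` for every
non-zero `P ∈ ℤ[x, y]` (`CodimOneMeasure 2 theta μ K C` for some `K ≥ 0`, `C > 0`). Dirichlet forces
`μ ≥ 2`; `μ = 2 + o(1)` is the generic truth; ANY `μ` makes `e`, `π` algebraically independent. -/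
def PairMeasure (μ : ℝ) : Prop :=
  ∃ K C : ℝ, 0 ≤ K ∧ CodimOneMeasure 2 theta μ K C

/-- **One-variable floor at `ξ` with degree exponent `A`** (some polynomial penalty exponent `K`
and constant `C`): `log|f(ξ)| ≥ −C((deg f)^A log H(f) + (deg f)^K)` for all non-zero `f ∈ ℤ[X]`. -/
def Floor (ξ : ℂ) (A : ℝ) : Prop :=
  ∃ K C : ℝ, SlotFloor ξ A K C

/-! ## §2 The three stubs (stated over LANDED tree declarations only — `CodimOneMeasure`, `SlotFloor`
of `Theorems/DiophantineDichotomyDefs.lean` and Mathlib — so that a prover's `Theorems/` file can restate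
each verbatim; `PairMeasure` / `Floor` above are this file's abbreviations of the same shapes) -/

/-- **Stub 1 — THE PAIR MEASURE (OPEN, HARDEST; the lead holds this one).** A decoupled
codimension-one measure of algebraic independence for `(π, e)` with ANY saving over the trivial
total-degree exponent `3`: `∃ μ < 3` (and `μ ≥ 0`, harmless: Dirichlet forces `μ ≥ 2` anyway),
`∃ K ≥ 0, C > 0`, `log|P(π, e)| ≥ −C((deg P)^μ log H(P) + (deg P)^K)` for all `P ∈ ℤ[x,y] ∖ 0`.
Why plausibly true: it is what genericity and Schanuel-type quantitative conjectures predict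
(`μ = 2 + o(1)`, Waldschmidt arXiv:math/0312440 Conj. 4 / GL326 Conj. 15.31). Why it might fail /
resist: it contains `e ⊥ π` with a measure; every known measure architecture at `(1, iπ)` is blocked
(barrier `LargeTranscendenceDegree`: the exp-bilinear closure of `{1, iπ} × {1, …}` drags `e^{−π²}`).
By itself it closes the CORE of the crux for every index bound `M` with `a = (μ−1)/2`
(`core_of_pairMeasure`); with Stubs 2–3 it closes the crux (`EPiSimultaneousType_of`). -/
theorem stub_pairMeasure : ∃ μ K C : ℝ, 0 ≤ μ ∧ μ < 3 ∧ 0 ≤ K ∧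
    CodimOneMeasure 2 ![(Real.pi : ℂ), (Real.exp 1 : ℂ)] μ K C := by
  sorry

/-- **Stub 2 — uniform polynomial type one for `e` (OPEN; the residual single-variable input of the
semi-entangled complement).** For every `A > 1` there are `K, C` with
`log|f(e)| ≥ −C((deg f)^A log H(f) + (deg f)^K)` for all `f ∈ ℤ[X] ∖ 0`. In print only for `A = 2`
(Nesterenko–Waldschmidt 1996 Thm 4(2), arXiv:math/0002047 p. 1: `|P(e)| ≥ exp{−1.3·10⁵ d²(log L + d)}`)
and, with `A = 1 + o(1)`, only at hyper-heights `log log H ≫ d² log d` (Popken 1929 / Mahler 1932,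
Bugeaud 2004 p. 83 (3.32)); the parent line's registered `stub_lwSmallHeight_one` (`LWSmallHeight 1`:
exponent `1` with polynomial penalty for every `e^β`) implies it (`eFloor_of_lwSmallHeight_one`).
Why it might fail: a polynomial penalty `(deg f)^K` at exponent `A → 1⁺` is exactly the open
"small-height Lindemann–Weierstrass" problem (Ably 1994 has an exponential penalty); no obstruction is
known (Dirichlet only forbids `A < 1`, Disproof §2b). Needed only with `A < 2/(μ−1)` for the `μ` of
Stub 1 (`cruxNF_of_pairMeasure_and_floors`). -/
theorem stub_eFloor : ∀ A : ℝ, 1 < A → ∃ K C : ℝ, SlotFloor (Real.exp 1 : ℂ) A K C := by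
  sorry

/-- **Stub 3 — Fel'dman-type floor for `π` (KNOWN in print; size L: vendor the named fact + `L ↔ H`
bookkeeping).** For every `A > 1` there are `K, C` with `log|f(π)| ≥ −C((deg f)^A log H(f) + (deg f)^K)`
for all `f ∈ ℤ[X] ∖ 0`: Nesterenko–Waldschmidt 1996 Thm 2(2) (arXiv:math/0002047 p. 1 L146–151:
`|P(π)| ≥ exp{−2·10⁶ d(log L + d log d)(1 + log d)}`, `L(P) ≤ L`, `L ≥ 3`) = Waldschmidt 1978 /
Fel'dman (Bugeaud 2004 §8.3 p. 183), with `d(1 + log d) ≤ c_A d^A`, `K = 3`. Why it might fail: it does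
not at truth level (transcription risk only). -/
theorem stub_piFloor : ∀ A : ℝ, 1 < A → ∃ K C : ℝ, SlotFloor (Real.pi : ℂ) A K C := by
  sorry

/-! ## §3 Landed machinery of the parent line (crux 6116, line `lw-small-height`) -/

/-- `CodimOneTransfer` is a THEOREM: Siegel's lemma inside the ideal of the challenger
(`stub_siegelInIdeal`, p76390) + Mahler–Weil heights and the mean value theorem
(`stub_transferOfSiegel`), both landed under `Theorems/`. -/
theorem codimOneTransfer_holds : CodimOneTransfer :=
  stub_transferOfSiegel stub_siegelInIdeal

/-- The pair measure with exponent `μ` gives the primitive approximation measure at `(π, e)` with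
`p = (μ+1)/2`, `q = (max μ K + 1)/2 + 1` (some constant). -/
theorem primitive_of_pairMeasure {μ : ℝ} (hμ : 0 ≤ μ) (h : PairMeasure μ) :
    ∃ q C : ℝ, 0 ≤ q ∧ PrimitiveApproxMeasure 2 theta ((μ + 1) / 2) q C := by
  obtain ⟨K, C, hK, hC⟩ := h
  obtain ⟨C', hP⟩ := codimOneTransfer_holds 2 theta μ K C (by norm_num) hμ hK hC
  refine ⟨(max μ K + 1) / (2 : ℕ) + 1, C', ?_, ?_⟩
  · have : (0 : ℝ) ≤ max μ K := hμ.trans (le_max_left _ _)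
    positivity
  · have h2 : ((μ + 1) / 2 : ℝ) = (μ + 1) / (2 : ℕ) := by norm_num
    rw [h2]
    exact hP

/-- Monotonicity of a codimension-one measure in its degree exponent. [folklore] -/
theorem codimOneMeasure_mono_exponent {m : ℕ} {ω : Fin m → ℂ} {μ μ' K C : ℝ} (hμ : μ ≤ μ')
    (h : CodimOneMeasure m ω μ K C) : CodimOneMeasure m ω μ' K C := by
  refine ⟨h.1, fun P hP => le_trans ?_ (h.2 P hP)⟩
  apply Real.exp_le_exp.2
  apply neg_le_neg
  have h1 : (1 : ℝ) ≤ max 1 (P.totalDegree : ℝ) := le_max_left _ _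
  have hlog : 0 ≤ Real.log (max 1 (mvNatHeight P : ℝ)) := Real.log_nonneg (le_max_left _ _)
  have hpow : (max 1 (P.totalDegree : ℝ)) ^ μ ≤ (max 1 (P.totalDegree : ℝ)) ^ μ' :=
    Real.rpow_le_rpow_of_exponent_le h1 hμ
  have hC : 0 ≤ C := h.1.le
  gcongr

/-- BRIDGE to the parent line: its registered stub `stub_lwSmallHeight_one` (`LWSmallHeight 1`,
small-height Lindemann–Weierstrass in one variable: exponent `1`, polynomial penalty, at every `e^β`,
`β ∈ ℚ̄ ∖ 0`) implies Stub 2 (take `β = 1` and weaken the exponent `1 ↦ A`). [folklore] -/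
theorem eFloor_of_lwSmallHeight_one (h : LWSmallHeight 1) :
    ∀ A : ℝ, 1 < A → ∃ K C : ℝ, SlotFloor (Real.exp 1 : ℂ) A K C := by
  intro A hA
  obtain ⟨K, C, -, hKC⟩ := h (fun _ => (1 : ℂ)) (fun _ => isAlgebraic_one)
    (linearIndependent_unique_iff.mpr one_ne_zero)
  have hfun : (Complex.exp ∘ fun _ : Fin 1 => (1 : ℂ)) = fun _ : Fin 1 => ((Real.exp 1 : ℝ) : ℂ) := by
    funext i
    simp [Complex.ofReal_exp]
  rw [hfun] at hKC
  refine ⟨K, C, ?_⟩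
  have hA' : ((1 : ℕ) : ℝ) ≤ A := by push_cast; exact hA.le
  exact codimOneMeasure_mono_exponent hA' hKC

/-! ## §4 The cut: slot dichotomy at `θ = (π, e)` (PROVED — the parent's `stub_slotDichotomy_two`
transplanted from `ℂ⁴` to `ℂ²`; its lemmas `slot_repulsion`, `bookkeeping_one/two` are imported) -/

/-- **Primitive pair measure + floors ⟹ the crux.** At `θ = (π, e)`, a primitive approximation
measure with exponents `(p, q)` plus one-variable floors with degree exponent `A` at both coordinates
give `CruxNF` with `a = A·p/(A+1) < 1` provided `A·p < A + 1`; `b = a + |q| + τ K⁺ + 3`,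
`τ = p/(A+1)`, `C' = 3(C + C₀ + C₁) + 5 + log(‖θ‖ + 2)`. Dichotomy at `d^τ`: if some coordinate has
degree `< d^τ` over `ℚ` (index `> d^{1−τ}`), the floor at it applied to an irreducible factor of the
clause's polynomial and the mean value theorem win (`slot_repulsion`); otherwise both coordinates have
degree `≥ d^τ` and the primitive measure with `d' = ⌈d^τ⌉` wins (`bookkeeping_one`). [folklore] -/
theorem cruxNF_of_primitive_and_floors {p q C A : ℝ} (hp : 0 ≤ p) (hA : 0 < A)
    (hrace : A * p < A + 1) (hPM : PrimitiveApproxMeasure 2 theta p q C)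
    (hfl : ∀ i : Fin 2, Floor (theta i) A) : CruxNF := by
  choose Kf Cf hKC using hfl
  set τ : ℝ := p / (A + 1) with hτ
  set a : ℝ := A * p / (A + 1) with ha
  set Kp : ℝ := max (max (Kf 0) (Kf 1)) 0 with hKp
  set b : ℝ := a + |q| + τ * Kp + 3 with hb
  set R : ℝ := ‖theta‖ + 2 with hR
  set C' : ℝ := 3 * (C + Cf 0 + Cf 1) + 5 + Real.log R with hC'
  have hA1 : 0 < A + 1 := by linarith
  have hτ0 : 0 ≤ τ := div_nonneg hp hA1.le
  have ha0 : 0 ≤ a := div_nonneg (mul_nonneg hA.le hp) hA1.le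
  have ha1 : a < 1 := by rw [ha, div_lt_one hA1]; exact hrace
  have hpa : p - τ = a := by rw [hτ, ha]; field_simp; ring
  have hτA : τ * A = a := by rw [hτ, ha]; ring
  have hKp0 : 0 ≤ Kp := le_max_right _ _
  have hτK : 0 ≤ τ * Kp := mul_nonneg hτ0 hKp0
  have hb1 : a + 1 ≤ b := by rw [hb]; linarith [abs_nonneg q]
  have hbq : q ≤ b := by rw [hb]; linarith [le_abs_self q]
  have hbK : τ * Kp ≤ b := by rw [hb]; linarith [abs_nonneg q]
  have hC0 : 0 < C := hPM.1
  have hCf0 : 0 < Cf 0 := (hKC 0).1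
  have hCf1 : 0 < Cf 1 := (hKC 1).1
  have hR1 : 1 ≤ R := by have := norm_nonneg theta; rw [hR]; linarith
  have hlogR : 0 ≤ Real.log R := Real.log_nonneg hR1
  have hC'pos : 0 < C' := by rw [hC']; linarith
  have hCC' : 2 * C ≤ C' := by rw [hC']; linarith
  have hKall : ∀ i : Fin 2, Kf i ≤ Kp := Fin.forall_fin_two.2
    ⟨(le_max_left _ _).trans (le_max_left _ _), (le_max_right _ _).trans (le_max_left _ _)⟩
  have hCall : ∀ i : Fin 2, 3 * Cf i + 4 + Real.log R ≤ C' := Fin.forall_fin_two.2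
    ⟨by rw [hC']; linarith, by rw [hC']; linarith⟩
  refine ⟨a, b, C', ha1, hC'pos, ?_⟩
  rintro d H γ ⟨hfr, hpoly⟩
  show Real.exp (-(C' * ((d : ℝ) ^ a * Real.log H + (d : ℝ) ^ b))) ≤ ‖γ - theta‖
  obtain ⟨P₀, hP₀0, hP₀deg, hP₀H, hP₀γ⟩ := hpoly 0
  have hd1 : 1 ≤ d := (natDegree_pos_of_aeval_eq_zero hP₀0 hP₀γ).1.trans_le hP₀deg
  have hH1 : (1 : ℤ) ≤ H :=
    (Int.one_le_abs (leadingCoeff_ne_zero.2 hP₀0)).trans (hP₀H P₀.natDegree)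
  have hd1r : (1 : ℝ) ≤ d := by exact_mod_cast hd1
  have hH1r : (1 : ℝ) ≤ H := by exact_mod_cast hH1
  have hd0 : (0 : ℝ) < d := one_pos.trans_le hd1r
  have hlogH : 0 ≤ Real.log H := Real.log_nonneg hH1r
  have hX0 : 0 ≤ C' * ((d : ℝ) ^ a * Real.log H + (d : ℝ) ^ b) :=
    mul_nonneg hC'pos.le (by linarith [mul_nonneg (Real.rpow_pos_of_pos hd0 a).le hlogH,
      (Real.rpow_pos_of_pos hd0 b).le])
  by_cases hfar : 1 < ‖γ - theta‖
  · exact le_trans (by rw [Real.exp_le_one_iff]; linarith) hfar.le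
  push Not at hfar
  have hcoord : ∀ j, ‖γ j - theta j‖ ≤ ‖γ - theta‖ := fun j => by
    simpa using norm_le_pi_norm (γ - theta) j
  have hθj : ∀ j, ‖theta j‖ ≤ ‖theta‖ := fun j => norm_le_pi_norm theta j
  by_cases hsmall : ∃ i : Fin 2, ((minpoly ℚ (γ i)).natDegree : ℝ) < (d : ℝ) ^ τ
  · -- SEMI-ENTANGLED CASE: a coordinate of small degree (large index) — floor at it + mean value
    obtain ⟨i, hi⟩ := hsmall
    obtain ⟨P, hP0, hPdeg, hPH, hPγ⟩ := hpoly i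
    have hξR : ‖theta i‖ ≤ R := by have := hθj i; rw [hR]; linarith
    have hαR : ‖γ i‖ ≤ R := by
      linarith [hcoord i, hθj i, norm_sub_norm_le (γ i) (theta i)]
    have hrep := slot_repulsion (hKC i) hA (hKall i) hKp0 hP0 hPdeg hPH hPγ hi.le hd1r hH1r hR1
      hξR hαR
    have hbk := bookkeeping_two (hKC i).1 (hCall i) hlogR hd1r hlogH hτA ha0 hb1 hbK
      (A := A) (Kp := Kp) (d := (d : ℝ))
    have hmul : Real.exp ((4 + Real.log R) * d + Real.log H) *
        Real.exp (-(C' * ((d : ℝ) ^ a * Real.log H + (d : ℝ) ^ b))) ≤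
        Real.exp ((4 + Real.log R) * d + Real.log H) * ‖γ i - theta i‖ := by
      rw [← Real.exp_add]
      exact le_trans (Real.exp_le_exp.2 (by linarith)) hrep
    exact (le_of_mul_le_mul_left hmul (Real.exp_pos _)).trans (hcoord i)
  · -- CORE-TYPE CASE: both coordinates of degree `≥ d^τ` (index `≤ d^{1−τ}`) — the pair measure
    push Not at hsmall
    have hkey := hPM.2 d ⌈(d : ℝ) ^ τ⌉₊ H γ
      (Nat.one_le_ceil_iff.2 (Real.rpow_pos_of_pos hd0 _)) hfr (fun i => Nat.ceil_le.2 (hsmall i))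
      hpoly
    have hbk := bookkeeping_one hC0 hCC' hd1r hlogH (Nat.le_ceil ((d : ℝ) ^ τ)) hpa hb1 hbq
      (q := q)
    exact le_trans (Real.exp_le_exp.2 (by linarith)) hkey

/-- The same with the pair measure in its native form: `PairMeasure μ` and floors with exponent `A` at
`π` and `e` give the crux as soon as `A(μ − 1) < 2` (`p = (μ+1)/2`, `A p < A + 1`). [folklore] -/
theorem cruxNF_of_pairMeasure_and_floors {μ A : ℝ} (hμ : 0 ≤ μ) (hA : 1 ≤ A)
    (hrace : A * (μ - 1) < 2) (hP : PairMeasure μ) (hπ : Floor (Real.pi : ℂ) A)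
    (he : Floor (Real.exp 1 : ℂ) A) : CruxNF := by
  obtain ⟨q, C, -, hPM⟩ := primitive_of_pairMeasure hμ hP
  have hp : (0 : ℝ) ≤ (μ + 1) / 2 := by positivity
  have hA0 : 0 < A := by linarith
  have hrace' : A * ((μ + 1) / 2) < A + 1 := by nlinarith
  refine cruxNF_of_primitive_and_floors hp hA0 hrace' hPM ?_
  exact Fin.forall_fin_two.2 ⟨hπ, he⟩

/-! ## §5 The crux from the line -/

/-- **The skeleton concludes the crux BY NAME.** `EPiSimultaneousType` (route `DiophantineDichotomy`,
stmt-Schanuel-6118) from the three registered stubs: the pair measure gives `μ < 3`; the floors are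
taken at `A = 1 + (3 − μ)/4 ∈ (1, 2/(μ−1))`, so `A(μ − 1) < 2`; output exponent
`a = A(μ+1)/(2(A+1)) < 1`. Axioms: standard + `sorryAx` (the three stubs only). -/
theorem EPiSimultaneousType_of : EPiSimultaneousType := by
  obtain ⟨μ, K, C, hμ0, hμ3, hK, hC⟩ := stub_pairMeasure
  have hP : PairMeasure μ := ⟨K, C, hK, hC⟩
  set A : ℝ := 1 + (3 - μ) / 4 with hA
  have hA1 : 1 < A := by rw [hA]; linarith
  have hrace : A * (μ - 1) < 2 := by
    rw [hA]; nlinarith [mul_pos (show (0 : ℝ) < 3 - μ by linarith) (show (0 : ℝ) < 5 - μ by linarith)]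
  exact crux_iff.mpr (cruxNF_of_pairMeasure_and_floors hμ0 hA1.le hrace hP (stub_piFloor A hA1)
    (stub_eFloor A hA1))

/-- **The exchange curve, other end** (documentation, PROVED): an OPTIMAL-exponent pair measure
(`PairMeasure μ` for every `μ > 2`, the generic truth) needs only SOME saving `A < 2` on the `e`-side
(and Fel'dman's floor for `π`) — choose `μ ∈ (2, 1 + 2/A)`. -/
theorem cruxNF_of_optimalPair_and_eSaving (hP : ∀ μ : ℝ, 2 < μ → PairMeasure μ)
    (he : ∃ A : ℝ, 1 < A ∧ A < 2 ∧ Floor (Real.exp 1 : ℂ) A)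
    (hπ : ∀ A : ℝ, 1 < A → Floor (Real.pi : ℂ) A) : CruxNF := by
  obtain ⟨A, hA1, hA2, heA⟩ := he
  have hA0 : 0 < A := by linarith
  -- `μ := 2 + (2 − A)/(2A)`: then `A(μ−1) = A + (2−A)/2 < 2`
  set μ : ℝ := 2 + (2 - A) / (2 * A) with hμ
  have hμ2 : 2 < μ := by
    have h' : 0 < (2 - A) / (2 * A) := div_pos (by linarith) (by linarith)
    rw [hμ]; linarith
  have hrace : A * (μ - 1) < 2 := by
    rw [hμ]
    have h1 : A * (2 + (2 - A) / (2 * A) - 1) = A + (2 - A) / 2 := by field_simp; ring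
    rw [h1]; linarith
  exact cruxNF_of_pairMeasure_and_floors (by linarith) hA1.le hrace (hP μ hμ2) (hπ A hA1) heA

/-! ## §6 The bounded-index CORE (the idea's first lemma, PROVED): on challengers of entanglement
index `≤ M` the pair measure ALONE gives the crux inequality, with exchange rate `a = (μ − 1)/2` -/

/-- Field degree `r(γ) = [ℚ(γ₁, γ₂) : ℚ]` of the challenger (`0` if some `γᵢ` is transcendental). -/
def fieldDeg (γ : Fin 2 → ℂ) : ℕ := Module.finrank ℚ ↥(IntermediateField.adjoin ℚ (Set.range γ))

/-- Coordinate degree `dᵢ = [ℚ(γᵢ) : ℚ] = deg minpoly_ℚ(γᵢ)` (`0` if `γᵢ` is transcendental). -/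
def coordDeg (γ : Fin 2 → ℂ) (i : Fin 2) : ℕ := (minpoly ℚ (γ i)).natDegree

/-- ENTANGLEMENT INDEX `≤ M`: each coordinate generates `ℚ(γ)` up to index `≤ M`, i.e.
`[ℚ(γ) : ℚ(γᵢ)] = r/dᵢ ≤ M` for `i = 0, 1`, written multiplicatively (tower law). An algebraic point
of an irreducible curve `Q(x, y) = 0` over `ℚ` with `deg_x Q, deg_y Q ≥ 1` has index `≤ deg Q`
(`γ₂` is a root of `Q(γ₁, y) ≢ 0`) — this is why the route's race only ever meets bounded index. -/
def IndexLE (M : ℕ) (γ : Fin 2 → ℂ) : Prop := ∀ i, fieldDeg γ ≤ M * coordDeg γ i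

/-- `Core M a b C` — the crux inequality with parameters `(a, b, C)` demanded ONLY of admissible
challengers of entanglement index `≤ M`. A restriction of the crux (`core_of_cruxNF`); at level `d`
every admissible challenger has index `≤ d` (`indexLE_level`), so `⋃_M Core M` exhausts the crux but
with `M`-dependent constants — the typed crux needs the power cut of §4, the route only `∀ M` (card). -/
def Core (M : ℕ) (a b C : ℝ) : Prop :=
  ∀ (d H : ℕ) (γ : Fin 2 → ℂ), Admissible d H γ → IndexLE M γ → bound a b C d H ≤ ‖γ - theta‖

/-- The core is a restriction of the crux. [folklore] -/
theorem core_of_cruxNF (h : CruxNF) : ∃ a b C : ℝ, a < 1 ∧ 0 < C ∧ ∀ M, Core M a b C := by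
  obtain ⟨a, b, C, ha, hC, h⟩ := h
  exact ⟨a, b, C, ha, hC, fun M d H γ hadm _ => h d H γ hadm⟩

/-- Under the clause every coordinate is integral over `ℚ`, of degree `≥ 1`. [folklore] -/
theorem isIntegral_of_clause {n H : ℕ} {z : ℂ} (h : Clause n H z) :
    IsIntegral ℚ z ∧ 1 ≤ (minpoly ℚ z).natDegree := by
  obtain ⟨P, hP0, -, -, hPz⟩ := h
  have hint := (natDegree_pos_of_aeval_eq_zero hP0 hPz).2
  exact ⟨hint, minpoly.natDegree_pos hint⟩

/-- At level `d` every admissible challenger has index `≤ d` (since `r ≤ d` and `dᵢ ≥ 1`). [folklore] -/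
theorem indexLE_level {d H : ℕ} {γ : Fin 2 → ℂ} (h : Admissible d H γ) : IndexLE d γ := by
  intro i
  have h1 := (isIntegral_of_clause (h.2 i)).2
  calc fieldDeg γ ≤ d := h.1
    _ = d * 1 := (mul_one d).symm
    _ ≤ d * coordDeg γ i := Nat.mul_le_mul_left d h1

/-- `log 8 ≤ 3` (`8 = 2³ ≤ e³`). [folklore] -/
theorem log_eight_le_three : Real.log 8 ≤ 3 := by
  have h2 : (2 : ℝ) ≤ Real.exp 1 := by linarith [Real.add_one_le_exp (1 : ℝ)]
  have h8 : (8 : ℝ) ≤ Real.exp 3 := by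
    calc (8 : ℝ) = 2 ^ 3 := by norm_num
      _ ≤ (Real.exp 1) ^ 3 := pow_le_pow_left₀ (by norm_num) h2 3
      _ = Real.exp 3 := by rw [← Real.exp_nat_mul]; norm_num
  calc Real.log 8 ≤ Real.log (Real.exp 3) := Real.log_le_log (by norm_num) h8
    _ = 3 := Real.log_exp 3

/-- Core bookkeeping (pure real arithmetic): with `1 ≤ r ≤ d`, `r/M ≤ d'`, `L' ≤ 3d + L`,
`C(r^p (L' + r)/d' + r^q) ≤ C(4M+1)(d^{p−1} L + d^{max p q})`. [folklore] -/
theorem bookkeeping_core {C p q M d r d' L L' : ℝ} (hC : 0 < C) (hM : 1 ≤ M) (hp : 1 ≤ p)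
    (hq : 0 ≤ q) (hd : 1 ≤ d) (hr1 : 1 ≤ r) (hrd : r ≤ d) (hd' : r / M ≤ d') (hL : 0 ≤ L)
    (hL'0 : 0 ≤ L') (hL' : L' ≤ 3 * d + L) :
    C * (r ^ p * (L' + r) / d' + r ^ q) ≤ C * (4 * M + 1) * (d ^ (p - 1) * L + d ^ max p q) := by
  have hr0 : 0 < r := one_pos.trans_le hr1
  have hd0 : 0 < d := one_pos.trans_le hd
  have hM0 : 0 < M := one_pos.trans_le hM
  have hrM : 0 < r / M := div_pos hr0 hM0
  have hrp0 : 0 ≤ r ^ p := (Real.rpow_pos_of_pos hr0 p).le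
  have hrp1 : 0 ≤ r ^ (p - 1) := (Real.rpow_pos_of_pos hr0 _).le
  have hdp1 : 0 ≤ d ^ (p - 1) := (Real.rpow_pos_of_pos hd0 _).le
  have hdm : 0 ≤ d ^ max p q := (Real.rpow_pos_of_pos hd0 _).le
  have e1 : r ^ p / d' ≤ M * r ^ (p - 1) := by
    calc r ^ p / d' ≤ r ^ p / (r / M) := div_le_div_of_nonneg_left hrp0 hrM hd'
      _ = M * r ^ (p - 1) := by rw [Real.rpow_sub_one hr0.ne']; field_simp
  have e2 : L' + r ≤ L + 4 * d := by linarith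
  have e3 : r ^ (p - 1) ≤ d ^ (p - 1) := Real.rpow_le_rpow hr0.le hrd (by linarith)
  have e4 : d ^ (p - 1) * d = d ^ p := by rw [Real.rpow_sub_one hd0.ne']; field_simp
  have e5 : d ^ p ≤ d ^ max p q := Real.rpow_le_rpow_of_exponent_le hd (le_max_left _ _)
  have e6 : r ^ q ≤ d ^ max p q :=
    (Real.rpow_le_rpow hr0.le hrd hq).trans (Real.rpow_le_rpow_of_exponent_le hd (le_max_right _ _))
  have f1 : r ^ p * (L' + r) / d' = (r ^ p / d') * (L' + r) := by ring
  have f2 : (r ^ p / d') * (L' + r) ≤ (M * r ^ (p - 1)) * (L + 4 * d) :=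
    mul_le_mul e1 e2 (by linarith) (mul_nonneg hM0.le hrp1)
  have f3 : M * r ^ (p - 1) * L ≤ M * d ^ (p - 1) * L :=
    mul_le_mul_of_nonneg_right (mul_le_mul_of_nonneg_left e3 hM0.le) hL
  have f4 : M * r ^ (p - 1) * d ≤ M * d ^ max p q := by
    calc M * r ^ (p - 1) * d ≤ M * d ^ (p - 1) * d :=
          mul_le_mul_of_nonneg_right (mul_le_mul_of_nonneg_left e3 hM0.le) hd0.le
      _ = M * d ^ p := by rw [mul_assoc, e4]
      _ ≤ M * d ^ max p q := mul_le_mul_of_nonneg_left e5 hM0.le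
  have t1 : r ^ p * (L' + r) / d' ≤ M * d ^ (p - 1) * L + 4 * (M * d ^ max p q) := by
    rw [f1]
    calc (r ^ p / d') * (L' + r) ≤ (M * r ^ (p - 1)) * (L + 4 * d) := f2
      _ = M * r ^ (p - 1) * L + 4 * (M * r ^ (p - 1) * d) := by ring
      _ ≤ M * d ^ (p - 1) * L + 4 * (M * d ^ max p q) := by linarith
  have hX : 0 ≤ d ^ (p - 1) * L := mul_nonneg hdp1 hL
  have key : r ^ p * (L' + r) / d' + r ^ q ≤ (4 * M + 1) * (d ^ (p - 1) * L + d ^ max p q) := by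
    nlinarith [mul_nonneg hM0.le hX, mul_nonneg hM0.le hdm]
  calc C * (r ^ p * (L' + r) / d' + r ^ q)
      ≤ C * ((4 * M + 1) * (d ^ (p - 1) * L + d ^ max p q)) := mul_le_mul_of_nonneg_left key hC.le
    _ = C * (4 * M + 1) * (d ^ (p - 1) * L + d ^ max p q) := by ring

/-- **FIRST LEMMA of the idea (exchange rate on the core)**: a primitive approximation measure at
`(π, e)` with exponents `(p, q)`, `p ≥ 1`, gives `Core M (p − 1) (max p q) (C(4M+1))` for EVERY
`M ≥ 1`. Proof: for a challenger of index `≤ M` admissible at `(d, H)`, normalise the level to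
`r = [ℚ(γ):ℚ] ≤ d` (irreducible witnesses of exact degree `dᵢ ≤ r` and height `≤ 8^d H`,
`EPiSimultaneousType.clause_irreducible`, LANDED), take `d' = ⌈r/M⌉ ≤ dᵢ`, apply the measure at
level `r`: cost `C(r^p(log H + 3d + r)·M/r + r^q) ≤ C(4M+1)(d^{p−1} log H + d^{max p q})`. [folklore] -/
theorem core_of_primitiveApproxMeasure {p q C : ℝ} (hp : 1 ≤ p) (hq : 0 ≤ q)
    (hPM : PrimitiveApproxMeasure 2 theta p q C) {M : ℕ} (hM : 1 ≤ M) :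
    Core M (p - 1) (max p q) (C * (4 * (M : ℝ) + 1)) := by
  rintro d H γ ⟨hfr, hpoly⟩ hidx
  show Real.exp (-(C * (4 * (M : ℝ) + 1) * ((d : ℝ) ^ (p - 1) * Real.log H + (d : ℝ) ^ max p q)))
    ≤ ‖γ - theta‖
  have hint : ∀ i, IsIntegral ℚ (γ i) := fun i => (isIntegral_of_clause (hpoly i)).1
  obtain ⟨P₀, hP₀0, hP₀deg, hP₀H, hP₀γ⟩ := hpoly 0
  have hd1 : 1 ≤ d := (natDegree_pos_of_aeval_eq_zero hP₀0 hP₀γ).1.trans_le hP₀deg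
  have hH1 : (1 : ℤ) ≤ H :=
    (Int.one_le_abs (leadingCoeff_ne_zero.2 hP₀0)).trans (hP₀H P₀.natDegree)
  have hd1r : (1 : ℝ) ≤ d := by exact_mod_cast hd1
  have hH1n : 1 ≤ H := by exact_mod_cast hH1
  have hH1r : (1 : ℝ) ≤ H := by exact_mod_cast hH1
  haveI hfd : FiniteDimensional ℚ ↥(IntermediateField.adjoin ℚ (Set.range γ)) :=
    IntermediateField.finiteDimensional_adjoin (fun x hx => by
      obtain ⟨j, rfl⟩ := hx
      exact hint j)
  -- the normalised level `r = [ℚ(γ):ℚ]`, `1 ≤ r ≤ d`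
  set r : ℕ := fieldDeg γ with hr
  have hr1 : 1 ≤ r := Module.finrank_pos
  have hrd : r ≤ d := hfr
  have hcoord : ∀ i, coordDeg γ i ≤ r := fun i => by
    show (minpoly ℚ (γ i)).natDegree ≤ Module.finrank ℚ ↥(IntermediateField.adjoin ℚ (Set.range γ))
    rw [← IntermediateField.adjoin.finrank (hint i)]
    exact IntermediateField.finrank_le_of_le_right
      (IntermediateField.adjoin.mono ℚ _ _ (Set.singleton_subset_iff.2 ⟨i, rfl⟩))
  -- irreducible witnesses at level `r`, height `8^d H`
  have hpoly' : ∀ i, ∃ Q : Polynomial ℤ, Q ≠ 0 ∧ Q.natDegree ≤ r ∧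
      (∀ k, |Q.coeff k| ≤ ((8 ^ d * H : ℕ) : ℤ)) ∧ Polynomial.aeval (γ i) Q = 0 := fun i => by
    obtain ⟨Q, hQirr, hQdeg, -, hQH, hQγ⟩ :=
      Summit.Schanuel.Schanuel.Theorems.EPiSimultaneousType.clause_irreducible (hpoly i)
    refine ⟨Q, hQirr.ne_zero, ?_, hQH, hQγ⟩
    rw [hQdeg, IntermediateField.adjoin.finrank (hint i)]
    exact hcoord i
  -- `d' = ⌈r/M⌉ ≤ dᵢ` by the index bound
  have hM0 : (0 : ℝ) < M := by exact_mod_cast hM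
  have hr1r : (1 : ℝ) ≤ r := by exact_mod_cast hr1
  have hrdr : (r : ℝ) ≤ d := by exact_mod_cast hrd
  set d' : ℕ := ⌈(r : ℝ) / M⌉₊ with hd'
  have hd'1 : 1 ≤ d' := Nat.one_le_ceil_iff.2 (div_pos (by linarith) hM0)
  have hd'le : ∀ i, d' ≤ (minpoly ℚ (γ i)).natDegree := fun i => by
    refine Nat.ceil_le.2 ?_
    rw [div_le_iff₀ hM0]
    have := hidx i
    have h' : (r : ℝ) ≤ (M : ℝ) * (coordDeg γ i : ℝ) := by exact_mod_cast this
    simpa [coordDeg, mul_comm] using h'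
  have hkey := hPM.2 r d' (8 ^ d * H) γ hd'1 le_rfl hd'le hpoly'
  refine le_trans (Real.exp_le_exp.2 (neg_le_neg ?_)) hkey
  -- bookkeeping
  have hL'eq : Real.log ((8 ^ d * H : ℕ) : ℝ) = d * Real.log 8 + Real.log H := by
    push_cast
    rw [Real.log_mul (by positivity) (by positivity), Real.log_pow]
  have hL'0 : 0 ≤ Real.log ((8 ^ d * H : ℕ) : ℝ) := Real.log_natCast_nonneg _
  have hL' : Real.log ((8 ^ d * H : ℕ) : ℝ) ≤ 3 * d + Real.log H := by
    rw [hL'eq]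
    have := log_eight_le_three
    nlinarith
  exact bookkeeping_core hPM.1 (by exact_mod_cast hM) hp hq hd1r hr1r hrdr (Nat.le_ceil _)
    (Real.log_nonneg hH1r) hL'0 hL'

/-- The pair measure is monotone in its exponent. [folklore] -/
theorem pairMeasure_mono {μ μ' : ℝ} (h : μ ≤ μ') (hP : PairMeasure μ) : PairMeasure μ' := by
  obtain ⟨K, C, hK, hC⟩ := hP
  exact ⟨K, C, hK, codimOneMeasure_mono_exponent h hC⟩

/-- **THE CORE FROM THE PAIR MEASURE ALONE** (the card's `core_of_codimOneMeasure`, now fully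
proved since `CodimOneTransfer` landed): `PairMeasure μ` with `1 ≤ μ` gives, for EVERY index bound
`M ≥ 1`, `Core M ((μ−1)/2) b C'` for some `b`, `C' > 0` — exchange rate `a = (μ − 1)/2`, so ANY
`μ < 3` yields SOME `a < 1` on every core, Dirichlet's `μ ≥ 2` maps to the Disproof's floor `a ≥ 1/2`,
the generic `μ = 2 + 2η` to `a = 1/2 + η`. No `e`-floor, no slot dichotomy, no box currency. [folklore] -/
theorem core_of_pairMeasure {μ : ℝ} (hμ : 1 ≤ μ) (hP : PairMeasure μ) {M : ℕ} (hM : 1 ≤ M) :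
    ∃ b C' : ℝ, 0 < C' ∧ Core M ((μ - 1) / 2) b C' := by
  obtain ⟨q, C, hq, hPM⟩ := primitive_of_pairMeasure (by linarith) hP
  have hp : (1 : ℝ) ≤ (μ + 1) / 2 := by linarith
  have h := core_of_primitiveApproxMeasure hp hq hPM hM
  have he : (μ + 1) / 2 - 1 = (μ - 1) / 2 := by ring
  rw [he] at h
  exact ⟨_, _, mul_pos hPM.1 (by positivity), h⟩

end Summit.Schanuel.Schanuel.Cruxes.EPiSimultaneousType.BoundedIndexCore

end
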